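import Literature.AlgebraicGeometry.HodgeTheory.RationalExteriorSpan
import Literature.AlgebraicGeometry.HodgeTheory.GysinBaseChange
import Literature.AlgebraicGeometry.HodgeTheory.TopDegreeClasses
import HarnessLib

/-!
# COR-CM model facts, exterior-algebra group: Künneth in degree one for a product of two smooth
# projective complex varieties (model axiom M21 `Fact_kunneth1`)

HONEST FRAMING (cell pub-hodgecm2 / COR-CM): a STANDARD fact about Betti cohomology on the tree's
real carriers; no case of the Hodge conjecture is proved and nothing about algebraic cycles is asserted.

Field M21 `kunneth1` of the stage-1 record `HodgeCM.Universe.ModelAxioms` (`HodgeCM/Geometry/Facts.lean`)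
reads, for all varieties `X Y` of the universe,

  `Function.Bijective ((U.pull (U.fst X Y) 1).coprod (U.pull (U.snd X Y) 1))`,

i.e. `H¹(X × Y, ℚ) = fst^* H¹(X, ℚ) ⊕ snd^* H¹(Y, ℚ)` (Voisin I Thm. 11.38; Hatcher Thm. 3.15: Künneth
in degree one for connected factors). In the model universe `HodgeCM.Model.universeOf` every variety is
the interpretation of a Picard–CM code, a smooth projective (geometrically irreducible) variety over `ℂ`
(`PicardCM.Var.isSmoothProjective`), products are the cartesian-monoidal product of `SchemeOver ℂ` with
its projections `CartesianMonoidalCategory.fst/snd` (`PicardCM.Var.fst/snd`), and `U.pull f 1` is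
`BettiUniverse.pull f 1`. So M21 for `universeOf` is the theorem `kunneth_one_bijective` below at
`hY := Var.isSmoothProjective hU h₃ X`, `hZ := Var.isSmoothProjective hU h₃ Y` (a one-line junction on
the package side; this file is scheme-level).

PROVED here, for smooth projective `Y, Z` over `ℂ` (dimensions `m, n`):
* `pull_fst_add_pull_snd_injective` — INJECTIVITY of `(a, b) ↦ fst^* a + snd^* b` on
  `H¹(Y(ℂ); ℚ) × H¹(Z(ℂ); ℚ)`: pull back along the continuous sections `y ↦ (y, z₀)`, `z ↦ (y₀, z)` of
  the projections (through the homeomorphism `(Y ⊗ Z)(ℂ) ≃ₜ Y(ℂ) × Z(ℂ)`,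
  `AlgPoints.isHomeomorph_prodEquiv_holds`; the points exist because `Y(ℂ)`, `Z(ℂ)` are connected,
  hence non-empty, SGA1 XII 2.4 = the tree's `connectedSpace_complexPoints`); a constant map kills `H¹`
  (Hatcher §3.1 p. 199);
* `span_pull_fst_pull_snd_eq_top` — SURJECTIVITY: `H¹((Y ⊗ Z)(ℂ); ℚ)` is spanned by `fst^* H¹(Y) ∪ snd^* H¹(Z)`;
  over `ℂ` this is the Künneth spanning theorem of the tree (`kunnethSpan_complexBetti`, Hatcher
  Thm. 3.15 via Leray–Hirsch) in degree `1 = 1 + 0 = 0 + 1` together with `H⁰ = ℂ · 1` of the connected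
  factors; the passage `ℂ → ℚ` is the descent lemma `span_eq_top_of_span_image_ofRatClass_eq_top` of
  `CorCM/RationalExteriorSpan.lean`;
* `kunneth_one_bijective` — the M21 shape verbatim (`LinearMap.coprod` of the two `BettiUniverse.pull`s).

## References
* [HatcherAT2002] A. Hatcher, *Algebraic Topology* (2002), §3.1 p. 199, §3.2 Thm. 3.15–3.16, §3.B Thm. 3B.6.
* [VoisinHodgeI2002] C. Voisin, *Hodge Theory and Complex Algebraic Geometry I* (2002), Thm. 11.38, §7.1.1.
* [SGA1] A. Grothendieck, SGA 1, Exp. XII Prop. 2.4.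

Provenance: Literature home (namespace `Literature.AlgebraicGeometry.HodgeTheory.RationalExteriorSpan`) of the Summits-side `CorCM/KunnethDegreeOne` (cell `pub-hodgecm2`, COR-CM; all its imports are `Literature/`, Mathlib and the already re-homed `RationalExteriorSpan`), which `Literature/` may not import; theorems only, no named fact, no definition. Nothing here bears on `HC_CM`. Lane `lit-hodgefound` (Layer A3: CM types, their Kubota ranks and Galois combinatorics), seat p20.
-/

noncomputable section

open _root_.CategoryTheory MonoidalCategory CartesianMonoidalCategory
open Literature.AlgebraicTopology.SingularHomology
open Literature.AlgebraicGeometry Literature.AlgebraicGeometry.Motives Literature.AlgebraicGeometry.HodgeTheory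

namespace Literature.AlgebraicGeometry.HodgeTheory.RationalExteriorSpan

section Kunneth

variable {m n : ℕ} {Y Z : SchemeOver ℂ}

/-- `Y(ℂ)` is path connected (hence non-empty) for `Y` smooth projective over `ℂ`: connected
(SGA1 XII Prop. 2.4, the tree's `connectedSpace_complexPoints`) and locally path connected (a
topological `2m`-manifold, `IsSmoothProjective.chartedSpace`). Local copy of the tree's
`Motives.IsSmoothProjective.pathConnectedSpace` (kept here to keep the import cone small). [cite: SGA1, Exp. XII Prop. 2.4] -/
theorem pathConnectedSpace_complexPoints (hY : IsSmoothProjective m Y) : PathConnectedSpace (ComplexPoints Y) := by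
  letI := hY.chartedSpace
  haveI : LocallyPathConnectedSpace (ComplexPoints Y) :=
    ChartedSpace.locallyPathConnectedSpace (H := EuclideanSpace ℝ (Fin (2 * m))) (M := ComplexPoints Y)
  haveI := connectedSpace_complexPoints hY
  exact pathConnectedSpace_iff_connectedSpace.2 inferInstance

/-- **Continuous sections of the first projection.** For every point `z₀ ∈ Z(ℂ)` there is a
continuous map `s : Y(ℂ) → (Y ⊗ Z)(ℂ)` ("`y ↦ (y, z₀)`", through the homeomorphism
`(Y ⊗ Z)(ℂ) ≃ₜ Y(ℂ) × Z(ℂ)` of the tree, `AlgPoints.isHomeomorph_prodEquiv_holds`) with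
`fst(ℂ) ∘ s = id` and `snd(ℂ) ∘ s = const z₀`. [cite: HatcherAT2002, §3.2 Thm. 3.15] -/
theorem exists_section_fst (Y Z : SchemeOver ℂ) (z₀ : ComplexPoints Z) :
    ∃ s : C(ComplexPoints Y, ComplexPoints (Y ⊗ Z)),
      (AlgPoints.mapContinuous (L := ℂ) (fst Y Z)).comp s = ContinuousMap.id _ ∧
        (AlgPoints.mapContinuous (L := ℂ) (snd Y Z)).comp s = ContinuousMap.const _ z₀ := by
  let e : ComplexPoints (Y ⊗ Z) ≃ₜ ComplexPoints Y × ComplexPoints Z :=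
    IsHomeomorph.homeomorph _ (AlgPoints.isHomeomorph_prodEquiv_holds (X := Y) (Y := Z) (L := ℂ))
  have he₁ : (ContinuousMap.fst : C(ComplexPoints Y × ComplexPoints Z, ComplexPoints Y)).comp
      (e : C(ComplexPoints (Y ⊗ Z), ComplexPoints Y × ComplexPoints Z)) =
      AlgPoints.mapContinuous (L := ℂ) (fst Y Z) := by
    refine ContinuousMap.ext fun P ↦ ?_
    change ((IsHomeomorph.homeomorph _
      (AlgPoints.isHomeomorph_prodEquiv_holds (X := Y) (Y := Z) (L := ℂ))) P).1 = AlgPoints.map (fst Y Z) P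
    rw [IsHomeomorph.homeomorph_apply]
    rfl
  have he₂ : (ContinuousMap.snd : C(ComplexPoints Y × ComplexPoints Z, ComplexPoints Z)).comp
      (e : C(ComplexPoints (Y ⊗ Z), ComplexPoints Y × ComplexPoints Z)) =
      AlgPoints.mapContinuous (L := ℂ) (snd Y Z) := by
    refine ContinuousMap.ext fun P ↦ ?_
    change ((IsHomeomorph.homeomorph _
      (AlgPoints.isHomeomorph_prodEquiv_holds (X := Y) (Y := Z) (L := ℂ))) P).2 = AlgPoints.map (snd Y Z) P
    rw [IsHomeomorph.homeomorph_apply]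
    rfl
  refine ⟨(e.symm : C(ComplexPoints Y × ComplexPoints Z, ComplexPoints (Y ⊗ Z))).comp
    ((ContinuousMap.id (ComplexPoints Y)).prodMk (ContinuousMap.const (ComplexPoints Y) z₀)), ?_, ?_⟩
  · rw [← he₁]
    refine ContinuousMap.ext fun y ↦ ?_
    simp
  · rw [← he₂]
    refine ContinuousMap.ext fun y ↦ ?_
    simp

/-- **Continuous sections of the second projection**: for every `y₀ ∈ Y(ℂ)` a continuous
`s : Z(ℂ) → (Y ⊗ Z)(ℂ)` ("`z ↦ (y₀, z)`") with `snd(ℂ) ∘ s = id` and `fst(ℂ) ∘ s = const y₀`. [cite: HatcherAT2002, §3.2 Thm. 3.15] -/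
theorem exists_section_snd (Y Z : SchemeOver ℂ) (y₀ : ComplexPoints Y) :
    ∃ s : C(ComplexPoints Z, ComplexPoints (Y ⊗ Z)),
      (AlgPoints.mapContinuous (L := ℂ) (snd Y Z)).comp s = ContinuousMap.id _ ∧
        (AlgPoints.mapContinuous (L := ℂ) (fst Y Z)).comp s = ContinuousMap.const _ y₀ := by
  let e : ComplexPoints (Y ⊗ Z) ≃ₜ ComplexPoints Y × ComplexPoints Z :=
    IsHomeomorph.homeomorph _ (AlgPoints.isHomeomorph_prodEquiv_holds (X := Y) (Y := Z) (L := ℂ))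
  have he₁ : (ContinuousMap.fst : C(ComplexPoints Y × ComplexPoints Z, ComplexPoints Y)).comp
      (e : C(ComplexPoints (Y ⊗ Z), ComplexPoints Y × ComplexPoints Z)) =
      AlgPoints.mapContinuous (L := ℂ) (fst Y Z) := by
    refine ContinuousMap.ext fun P ↦ ?_
    change ((IsHomeomorph.homeomorph _
      (AlgPoints.isHomeomorph_prodEquiv_holds (X := Y) (Y := Z) (L := ℂ))) P).1 = AlgPoints.map (fst Y Z) P
    rw [IsHomeomorph.homeomorph_apply]
    rfl
  have he₂ : (ContinuousMap.snd : C(ComplexPoints Y × ComplexPoints Z, ComplexPoints Z)).comp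
      (e : C(ComplexPoints (Y ⊗ Z), ComplexPoints Y × ComplexPoints Z)) =
      AlgPoints.mapContinuous (L := ℂ) (snd Y Z) := by
    refine ContinuousMap.ext fun P ↦ ?_
    change ((IsHomeomorph.homeomorph _
      (AlgPoints.isHomeomorph_prodEquiv_holds (X := Y) (Y := Z) (L := ℂ))) P).2 = AlgPoints.map (snd Y Z) P
    rw [IsHomeomorph.homeomorph_apply]
    rfl
  refine ⟨(e.symm : C(ComplexPoints Y × ComplexPoints Z, ComplexPoints (Y ⊗ Z))).comp
    ((ContinuousMap.const (ComplexPoints Z) y₀).prodMk (ContinuousMap.id (ComplexPoints Z))), ?_, ?_⟩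
  · rw [← he₂]
    refine ContinuousMap.ext fun z ↦ ?_
    simp
  · rw [← he₁]
    refine ContinuousMap.ext fun z ↦ ?_
    simp

/-- **Künneth in degree one, injectivity half**: for `Y, Z` smooth projective over `ℂ`, if
`fst^* a + snd^* b = 0` in `H¹((Y ⊗ Z)(ℂ); ℚ)` then `a = 0` and `b = 0` (pull back along the sections
`y ↦ (y, z₀)` and `z ↦ (y₀, z)`; a constant map kills `H¹`). [cite: HatcherAT2002, §3.2 Thm. 3.15 and §3.1 p. 199] -/
theorem pull_fst_add_pull_snd_injective (hY : IsSmoothProjective m Y) (hZ : IsSmoothProjective n Z) :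
    Function.Injective ((BettiUniverse.pull (fst Y Z) 1).coprod (BettiUniverse.pull (snd Y Z) 1)) := by
  haveI := pathConnectedSpace_complexPoints hY
  haveI := pathConnectedSpace_complexPoints hZ
  obtain ⟨y₀⟩ := (inferInstance : Nonempty (ComplexPoints Y))
  obtain ⟨z₀⟩ := (inferInstance : Nonempty (ComplexPoints Z))
  obtain ⟨sY, hsY₁, hsY₂⟩ := exists_section_fst Y Z z₀
  obtain ⟨sZ, hsZ₁, hsZ₂⟩ := exists_section_snd Y Z y₀
  rw [← LinearMap.ker_eq_bot, Submodule.eq_bot_iff]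
  rintro ⟨a, b⟩ hab
  rw [LinearMap.mem_ker, LinearMap.coprod_apply] at hab
  -- `fst^* a + snd^* b = 0`; pull back along the two sections
  have ha : a = 0 := by
    have h := congrArg (singularCohomology.map ℚ ℚ (sY) 1) hab
    rw [map_add, map_zero] at h
    change singularCohomology.map ℚ ℚ (sY) 1
        (singularCohomology.map ℚ ℚ (AlgPoints.mapContinuous (L := ℂ) (fst Y Z)) 1 a) +
      singularCohomology.map ℚ ℚ (sY) 1
        (singularCohomology.map ℚ ℚ (AlgPoints.mapContinuous (L := ℂ) (snd Y Z)) 1 b) = 0 at h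
    rw [← CategoryTheory.comp_apply, ← singularCohomology.map_comp, hsY₁,
      ← CategoryTheory.comp_apply, ← singularCohomology.map_comp, hsY₂,
      singularCohomology.map_id, CategoryTheory.id_apply,
      singularCohomology.map_const_of_ne_zero ℚ z₀ one_ne_zero, add_zero] at h
    exact h
  have hb : b = 0 := by
    have h := congrArg (singularCohomology.map ℚ ℚ (sZ) 1) hab
    rw [map_add, map_zero] at h
    change singularCohomology.map ℚ ℚ (sZ) 1
        (singularCohomology.map ℚ ℚ (AlgPoints.mapContinuous (L := ℂ) (fst Y Z)) 1 a) +
      singularCohomology.map ℚ ℚ (sZ) 1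
        (singularCohomology.map ℚ ℚ (AlgPoints.mapContinuous (L := ℂ) (snd Y Z)) 1 b) = 0 at h
    rw [← CategoryTheory.comp_apply, ← singularCohomology.map_comp, hsZ₂,
      ← CategoryTheory.comp_apply, ← singularCohomology.map_comp, hsZ₁,
      singularCohomology.map_id, CategoryTheory.id_apply,
      singularCohomology.map_const_of_ne_zero ℚ y₀ one_ne_zero, zero_add] at h
    exact h
  rw [ha, hb]
  rfl

/-- **Künneth in degree one, spanning half**: for `Y, Z` smooth projective over `ℂ`,
`H¹((Y ⊗ Z)(ℂ); ℚ)` is spanned over `ℚ` by `fst^* H¹(Y(ℂ); ℚ) ∪ snd^* H¹(Z(ℂ); ℚ)` (over `ℂ`: the tree's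
Künneth spanning theorem `kunnethSpan_complexBetti` in degree `1`, with `H⁰ = ℂ · 1` of the connected
factors; then descent `ℂ → ℚ`). [cite: HatcherAT2002, §3.2 Thm. 3.15] [cite: VoisinHodgeI2002, Thm. 11.38] -/
theorem span_pull_fst_pull_snd_eq_top (hY : IsSmoothProjective m Y) (hZ : IsSmoothProjective n Z) :
    Submodule.span ℚ (Set.range (BettiUniverse.pull (fst Y Z) 1) ∪ Set.range (BettiUniverse.pull (snd Y Z) 1)) = ⊤ := by
  haveI := pathConnectedSpace_complexPoints hY
  haveI := pathConnectedSpace_complexPoints hZ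
  have hYZ : IsSmoothProjective (m + n) (Y ⊗ Z) := IsSmoothProjective.tensor_holds hY hZ
  refine span_eq_top_of_span_image_ofRatClass_eq_top hYZ 1 _ (eq_top_iff.2 fun z _ ↦ ?_)
  set T := Submodule.span ℂ (ofRatClass (ComplexPoints (Y ⊗ Z)) 1 ''
    (Set.range (BettiUniverse.pull (fst Y Z) 1) ∪ Set.range (BettiUniverse.pull (snd Y Z) 1))) with hT
  -- the complexified generators contain `fst^* H¹(Y(ℂ); ℂ)` and `snd^* H¹(Z(ℂ); ℂ)`
  have hrat : ∀ {W : SchemeOver ℂ} {k : ℕ} (hW : IsSmoothProjective k W) (x : complexBetti W 1),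
      x ∈ Submodule.span ℂ (Set.range (ofRatClass (ComplexPoints W) 1)) := by
    intro W k hW x
    have hset : {c : complexBetti W 1 | IsRationalClass c} = Set.range (ofRatClass (ComplexPoints W) 1) := by
      ext c
      exact isRationalClass_iff_mem_range_ofRatClass c
    rw [← hset, span_isRationalClass_eq_top_of_isSmoothProjective_holds k W hW 1]
    exact Submodule.mem_top
  have hfst : ∀ b : complexBetti Y 1, (complexBetti.map (fst Y Z) 1) b ∈ T := by
    intro b
    refine Submodule.span_induction (fun x hx ↦ ?_) (by rw [map_zero]; exact T.zero_mem)
      (fun x y _ _ hx hy ↦ by rw [map_add]; exact T.add_mem hx hy)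
      (fun c x _ hx ↦ by rw [map_smul]; exact T.smul_mem c hx) (hrat hY b)
    obtain ⟨a, rfl⟩ := hx
    refine Submodule.subset_span ⟨BettiUniverse.pull (fst Y Z) 1 a, Or.inl ⟨a, rfl⟩, ?_⟩
    exact Motives.ofRatClass_map 1 (AlgPoints.mapContinuous (L := ℂ) (fst Y Z)) a
  have hsnd : ∀ w : complexBetti Z 1, (complexBetti.map (snd Y Z) 1) w ∈ T := by
    intro w
    refine Submodule.span_induction (fun x hx ↦ ?_) (by rw [map_zero]; exact T.zero_mem)
      (fun x y _ _ hx hy ↦ by rw [map_add]; exact T.add_mem hx hy)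
      (fun c x _ hx ↦ by rw [map_smul]; exact T.smul_mem c hx) (hrat hZ w)
    obtain ⟨a, rfl⟩ := hx
    refine Submodule.subset_span ⟨BettiUniverse.pull (snd Y Z) 1 a, Or.inr ⟨a, rfl⟩, ?_⟩
    exact Motives.ofRatClass_map 1 (AlgPoints.mapContinuous (L := ℂ) (snd Y Z)) a
  refine Submodule.span_le.2 ?_ (kunnethSpan_complexBetti hY hZ 1 z)
  rintro _ ⟨i, j, h, b, w, rfl⟩
  -- degree bookkeeping: `(i, j) = (0, 1)` or `(1, 0)`
  rcases i with _ | _ | i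
  · -- `i = 0`, `j = 1`: `fst^* b ∪ snd^* w` with `b ∈ H⁰(Y(ℂ); ℂ) = ℂ · 1`
    obtain rfl : j = 1 := by omega
    rw [singularCohomology.eq_smul_one ℂ b, map_smul, LinearMap.map_smul₂, singularCohomology.map_one,
      one_cupProduct']
    exact T.smul_mem _ (hsnd w)
  · -- `i = 1`, `j = 0`: `fst^* b ∪ snd^* w` with `w ∈ H⁰(Z(ℂ); ℂ) = ℂ · 1`
    obtain rfl : j = 0 := by omega
    rw [singularCohomology.eq_smul_one ℂ w, map_smul, map_smul, singularCohomology.map_one,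
      cupProduct_one']
    exact T.smul_mem _ (hfst b)
  · exfalso; omega

/-- **Model axiom M21 (`Fact_kunneth1`), scheme-level form — Künneth in degree one.** For `Y, Z`
smooth projective over `ℂ`, the map `H¹(Y(ℂ); ℚ) × H¹(Z(ℂ); ℚ) → H¹((Y ⊗ Z)(ℂ); ℚ)`,
`(a, b) ↦ fst^* a + snd^* b`, is bijective, in the `BettiUniverse.pull` / `CartesianMonoidalCategory.fst/snd`
spelling of the model universe (`PicardCM.Var.fst/snd`). At `hY := Var.isSmoothProjective hU h₃ X`,
`hZ := Var.isSmoothProjective hU h₃ Y` this is field `kunneth1` of `HodgeCM.Universe.ModelAxioms` for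
`HodgeCM.Model.universeOf`. [cite: VoisinHodgeI2002, Thm. 11.38] [cite: HatcherAT2002, §3.2 Thm. 3.15] -/
theorem kunneth_one_bijective (hY : IsSmoothProjective m Y) (hZ : IsSmoothProjective n Z) :
    Function.Bijective ((BettiUniverse.pull (fst Y Z) 1).coprod (BettiUniverse.pull (snd Y Z) 1)) := by
  refine ⟨pull_fst_add_pull_snd_injective hY hZ, ?_⟩
  rw [← LinearMap.range_eq_top, LinearMap.range_coprod, eq_top_iff, ← span_pull_fst_pull_snd_eq_top hY hZ,
    Submodule.span_le]
  rintro x (⟨a, rfl⟩ | ⟨b, rfl⟩)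
  · exact Submodule.mem_sup_left ⟨a, rfl⟩
  · exact Submodule.mem_sup_right ⟨b, rfl⟩

end Kunneth

end Literature.AlgebraicGeometry.HodgeTheory.RationalExteriorSpan

end
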